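import Summits.AtomisticToContinuum.Crystallization.Theses.FluxTubeKepler
import Summits.AtomisticToContinuum.Crystallization.Theorems.PhononSlackCertificatesHullBridgeWindows
import Summits.AtomisticToContinuum.Crystallization.Theorems.HullMinimalityLayeredWindowsFrequently

/-!
# `FluxCellKepler` (stmt-AtomisticToContinuum-15221), line `Sketch` — stub A
# `stub_layeredWindowsOfGoodSites`: layered windows from good sites (compactness in the spacing)

Potential-free COMPACTNESS-IN-THE-SPACING step of the skeleton `Lines/Sketch.lean` of the crux
`FluxTubeKepler.FluxCellKepler`.  For ANY sequence of finite configurations `x N` of `ℝ³`: if for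
every scale `(R, η)` (`R, η > 0`), frequently in `N`, some site `i` of `x N` is
`(R, η)`-layered-good — the set of relative positions `x N j - x N i` is two-way `η`-matched on
the `R`-ball with a layered (relaxed Barlow) set of SOME spacing `a ∈ [47/50, 1]` — then ONE
spacing `a ∈ [47/50, 1]` serves every scale: for every `(R, ε)` with `ε > 0`, frequently in `N`,
some translate `x N + t` is two-way `ε`-matched on `B(0, R)` with a layered set of spacing `a`
(verbatim the window clause of `HullMinimality.LayeredWindows`).

Proof (the pattern of `HullBridgeExact.stub_windowsOfGluing` /
`LayeredWindowsLocal.windowsOfGluing_freq`, with the gluing input replaced by the good-site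
hypothesis):

* a good site `i` of `x N` at scale `(R', η')` with spacing `a'` IS an `(R', η')`-window of `x N`
  of spacing `a'`, with translation `t := -(x N i)` (`x N j + t = x N j - x N i`);
* the set `W N R ε ⊆ [47/50, 1]` of admissible spacings of `(R, ε)`-windows of `x N` is monotone
  (`hb_window_mono`), trivial for `R < 0` (`hb_window_neg`), stable under the homothety
  `hb_window_rescale`, and — by the hypothesis at scale `(max R 1, ε)` and monotonicity — nonempty
  frequently in `N`;
* the accumulation-point lemma `LayeredWindowsLocal.hb_exists_global_spacing_freq` then yields one
  spacing serving every scale frequently in `N`.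

No new definitions.
-/

noncomputable section

namespace Summit.AtomisticToContinuum.Crystallization.Theorems.FluxCellKeplerSketch

open Filter
open Literature.MathematicalPhysics.StatisticalMechanics

/-- **A good site is a window.** If the relative positions `y j - y i` about the site `i` are
two-way `η`-matched on the `R`-ball with the layered set of `(A, s, z)` and spacing `a`, then the
translate `y + t`, `t := -(y i)`, is an `(R, η)`-window of spacing `a` (same `A, s, z`): indeed
`y j + (-(y i)) = y j - y i`, and the two set-builder layered sets agree up to the names of the
bound variables. [folklore] -/
theorem window_of_goodSite {N : ℕ} (y : Fin N → EuclideanSpace ℝ (Fin 3)) (i : Fin N)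
    {R η a : ℝ}
    (h : ∃ (A : EuclideanSpace ℝ (Fin 3) →ₗᵢ[ℝ] EuclideanSpace ℝ (Fin 3)) (s : ℤ → ℤ) (z : ℤ → ℝ),
      IsHaggSeq s ∧ (∀ m : ℤ, 39 / 50 * a ≤ z (m + 1) - z m ∧ z (m + 1) - z m ≤ 17 / 20 * a) ∧
      let S : Set (EuclideanSpace ℝ (Fin 3)) := {p | ∃ m k l : ℤ, p = A (((k : ℝ) • triangularVec₁ a) +
        ((l : ℝ) • triangularVec₂ a) + ((haggLabel s m : ℝ) • barlowOffset a) + (z m • layerNormal 1))}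
      (∀ p ∈ S, ‖p‖ ≤ R → ∃ j : Fin N, dist (y j - y i) p ≤ η) ∧
        (∀ j : Fin N, ‖y j - y i‖ ≤ R → ∃ p ∈ S, dist (y j - y i) p ≤ η)) :
    ∃ (A : EuclideanSpace ℝ (Fin 3) →ₗᵢ[ℝ] EuclideanSpace ℝ (Fin 3)) (t : EuclideanSpace ℝ (Fin 3))
      (s : ℤ → ℤ) (z : ℤ → ℝ), IsHaggSeq s ∧
      (∀ m : ℤ, 39 / 50 * a ≤ z (m + 1) - z m ∧ z (m + 1) - z m ≤ 17 / 20 * a) ∧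
      let S : Set (EuclideanSpace ℝ (Fin 3)) := {p | ∃ m i j : ℤ, p = A (((i : ℝ) • triangularVec₁ a) +
        ((j : ℝ) • triangularVec₂ a) + ((haggLabel s m : ℝ) • barlowOffset a) + (z m • layerNormal 1))}
      (∀ p ∈ S, ‖p‖ ≤ R → ∃ i : Fin N, dist (y i + t) p ≤ η) ∧
        (∀ i : Fin N, ‖y i + t‖ ≤ R → ∃ p ∈ S, dist (y i + t) p ≤ η) := by
  obtain ⟨A, s, z, hs, hz, h12⟩ := h
  dsimp only at h12
  refine ⟨A, -(y i), s, z, hs, hz, ?_⟩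
  dsimp only
  have e : ∀ j : Fin N, y j + -y i = y j - y i := fun j => (sub_eq_add_neg (y j) (y i)).symm
  simp only [e]
  exact h12

/-- **Stub A — layered windows from good sites (potential-free compactness in the spacing).** For
ANY sequence of finite configurations `x N`: if for every scale `(R, η)` (`R, η > 0`), frequently in
`N`, some site of `x N` is `(R, η)`-layered-good (its `R`-neighbourhood of relative positions is
two-way `η`-matched with a member of the relaxed Barlow / layered family of SOME spacing
`a ∈ [47/50, 1]`), then ONE spacing `a ∈ [47/50, 1]` serves every scale: for every `(R, ε)`,
frequently in `N`, some translate `x N + t` is two-way `ε`-matched on `B(0, R)` with a layered set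
of spacing `a` (verbatim the window clause of `HullMinimality.LayeredWindows`).  Proof: a good site
`i` is a window with `t = -x N i` (`window_of_goodSite`); the set of admissible spacings of
`(R, ε)`-windows of `x N` satisfies the hypotheses of the accumulation-point lemma
`LayeredWindowsLocal.hb_exists_global_spacing_freq` (`hb_window_mono`, `hb_window_neg`,
`hb_window_rescale`; nonempty frequently in `N` by the hypothesis at scale `(max R 1, ε)`).
[folklore] -/
theorem stub_layeredWindowsOfGoodSites :
    ∀ x : (N : ℕ) → (Fin N → EuclideanSpace ℝ (Fin 3)),
      (∀ R η : ℝ, 0 < R → 0 < η → ∃ᶠ N in Filter.atTop, ∃ i : Fin N, ∃ a : ℝ, 47 / 50 ≤ a ∧ a ≤ 1 ∧ ∃ (A : EuclideanSpace ℝ (Fin 3) →ₗᵢ[ℝ] EuclideanSpace ℝ (Fin 3)) (s : ℤ → ℤ) (z : ℤ → ℝ), IsHaggSeq s ∧ (∀ m : ℤ, 39 / 50 * a ≤ z (m + 1) - z m ∧ z (m + 1) - z m ≤ 17 / 20 * a) ∧ let S : Set (EuclideanSpace ℝ (Fin 3)) := {p | ∃ m k l : ℤ, p = A (((k : ℝ)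 • triangularVec₁ a) + ((l : ℝ) • triangularVec₂ a) + ((haggLabel s m : ℝ) • barlowOffset a) + (z m • layerNormal 1))}; (∀ p ∈ S, ‖p‖ ≤ R → ∃ j : Fin N, dist (x N j - x N i) p ≤ η) ∧ (∀ j : Fin N, ‖x N j - x N i‖ ≤ R → ∃ p ∈ S, dist (x N j - x N i) p ≤ η)) →
      ∃ a : ℝ, 47 / 50 ≤ a ∧ a ≤ 1 ∧ ∀ R ε : ℝ, 0 < ε → ∃ᶠ N in Filter.atTop, ∃ (A : EuclideanSpace ℝ (Fin 3) →ₗᵢ[ℝ] EuclideanSpace ℝ (Fin 3)) (t : EuclideanSpace ℝ (Fin 3)) (s : ℤ → ℤ) (z : ℤ → ℝ), IsHaggSeq s ∧ (∀ m : ℤ, 39 / 50 * a ≤ z (m + 1) - z m ∧ z (m + 1) - z m ≤ 17 / 20 * a) ∧ let S : Set (EuclideanSpace ℝ (Fin 3)) := {p | ∃ m i j : ℤ, p = A (((i : ℝ) • triangularVec₁ a) + ((j : ℝ) • triangularVec₂ a) + ((haggLabel s m : ℝ) • barlowOffset a) + (z m • layerNormal 1))}; (∀ p ∈ S, ‖p‖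 ≤ R → ∃ i : Fin N, dist (x N i + t) p ≤ ε) ∧ (∀ i : Fin N, ‖x N i + t‖ ≤ R → ∃ p ∈ S, dist (x N i + t) p ≤ ε) := by
  intro x hgood
  -- the set of admissible spacings of `(R, ε)`-windows of `x N`
  let W : ℕ → ℝ → ℝ → Set ℝ := fun N R ε =>
    {a | a ∈ Set.Icc (47 / 50 : ℝ) 1 ∧
      ∃ (A : EuclideanSpace ℝ (Fin 3) →ₗᵢ[ℝ] EuclideanSpace ℝ (Fin 3)) (t : EuclideanSpace ℝ (Fin 3))
        (s : ℤ → ℤ) (z : ℤ → ℝ), IsHaggSeq s ∧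
        (∀ m : ℤ, 39 / 50 * a ≤ z (m + 1) - z m ∧ z (m + 1) - z m ≤ 17 / 20 * a) ∧
        let S : Set (EuclideanSpace ℝ (Fin 3)) := {p | ∃ m i j : ℤ, p = A (((i : ℝ) • triangularVec₁ a) +
          ((j : ℝ) • triangularVec₂ a) + ((haggLabel s m : ℝ) • barlowOffset a) +
          (z m • layerNormal 1))}
        (∀ p ∈ S, ‖p‖ ≤ R → ∃ i : Fin N, dist (x N i + t) p ≤ ε) ∧
          (∀ i : Fin N, ‖x N i + t‖ ≤ R → ∃ p ∈ S, dist (x N i + t) p ≤ ε)}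
  have hbox : ∀ N R ε, W N R ε ⊆ Set.Icc (47 / 50 : ℝ) 1 := fun N R ε a ha => ha.1
  have hmono : ∀ N R R₂ ε ε₂, R₂ ≤ R → ε ≤ ε₂ → W N R ε ⊆ W N R₂ ε₂ :=
    fun N R R₂ ε ε₂ hR hε a ha => ⟨ha.1, hb_window_mono (x N) hR hε ha.2⟩
  have hneg : ∀ N R ε a, R < 0 → a ∈ Set.Icc (47 / 50 : ℝ) 1 → a ∈ W N R ε :=
    fun N R ε a hR ha => ⟨ha, hb_window_neg (x N) hR (by linarith [ha.1])⟩
  have hresc : ∀ N R ε a a', 0 ≤ R → 0 < ε → a' ∈ W N (2 * R + 1) (ε / 2) →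
      a ∈ Set.Icc (47 / 50 : ℝ) 1 → |a - a'| ≤ ε / (8 * (R + 1)) → a ∈ W N R ε :=
    fun N R ε a a' hR hε ha' ha haa =>
      ⟨ha, hb_window_rescale (x N) hR hε ha.1 ha.2 ha'.1.1 ha'.1.2 haa ha'.2⟩
  -- good sites at scale `(max R 1, ε)` frequently give `(R, ε)`-windows frequently
  have hne : ∀ R ε, 0 < ε → ∃ᶠ N in atTop, (W N R ε).Nonempty := by
    intro R ε hε
    refine (hgood (max R 1) ε (lt_max_of_lt_right one_pos) hε).mono fun N hN => ?_
    obtain ⟨i, a, ha, ha1, hW⟩ := hN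
    exact ⟨a, ⟨ha, ha1⟩,
      hb_window_mono (x N) (le_max_left R 1) le_rfl (window_of_goodSite (x N) i hW)⟩
  obtain ⟨a, ha, hwin⟩ :=
    LayeredWindowsLocal.hb_exists_global_spacing_freq W hbox hmono hneg hresc hne
  exact ⟨a, ha.1, ha.2, fun R ε hε => (hwin R ε hε).mono fun N hN => hN.2⟩

end Summit.AtomisticToContinuum.Crystallization.Theorems.FluxCellKeplerSketch

end
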